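import Summits.CriticalPhenomena.PercolationContinuityZ3.Theorems.Transplant.StatementHeisenbergGRR
import Summits.CriticalPhenomena.PercolationContinuityZ3.Theorems.Transplant.HeisenbergGRRFrm
import HarnessLib

/-!
# Transplant target 4-C2(H-GRR) BY NAME from the frames-only node: `SamePDropOfSkeletonFrm₁ → HeisenbergGRRCriticalContinuity`
# (the point-symmetry-free Cayley graph `X = Cay(H₃(ℤ); {a, b, ab, ba²}^{±1})` of the Heisenberg group at its own critical point)

builds on p205010 (kernel theorem, internal audit signed; external expert review pending) — nothing in this file uses p205010; NOTHING is claimed about the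
open node `SamePDropOfSkeletonFrm₁` (N2) and the target stays OPEN: this file is the one-line LINK between two named declarations already in the tree.
Status sentence (coordinator 2026-08-20T04:30Z): "θ(p_c) = 0 on ℤ^d, all d ≥ 2 — kernel-verified (Lean 4/Mathlib, standard axioms); internal
adversarial audit SIGNED 2026-08-20 04:29Z; external expert review pending."
Lane `prim-bschramm-*`, seat `prim-bschramm-stmt` (gen 23; statements typer — STATEMENTS.md §4 'which node closes which target'); helper file
(`--supports stmt-CriticalPhenomena-4575 --as helper`).

The target `HeisenbergGRRCriticalContinuity` (`Transplant/StatementHeisenbergGRR.lean` §3, stmt gen 11, `@[conjecture]`, OPEN: `θ_X((0,0,0), p_c(X)) = 0` over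
p5-g6's GRR carrier `HeisGRR.X`, `Aut X = H₃(ℤ)`, EVERY symmetric skeleton interface of the lane empty on `X`) is reached by exactly one typed node: the
single-type frames-only node N2, through p1-g15's sheared one-type `PlanarSkeletonFrm` on `X` and its conditional one-liner
`HeisGRR.criticalContinuity_of_frmNode₁ : SamePDropOfSkeletonFrm₁ → ∀ g, θ_X(g, p_c) = 0` (`Transplant/HeisenbergGRRFrm.lean` §2).  Recorded here AT THE
NAMED TARGET, so that the node file of record closes the target by `heisenbergGRRCriticalContinuity_of_frmNode₁ samePDropOfSkeletonFrm₁_holds` and nothing else: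
* `heisenbergGRRCriticalContinuity_of_frmNode₁ : SamePDropOfSkeletonFrm₁ → HeisenbergGRRCriticalContinuity`;
* `heisenbergGRRCriticalContinuity_all_of_frmNode₁` — the every-vertex form (`heisenbergGRRCriticalContinuity_iff_all`).
[cite: BenjaminiSchramm1996, Conj. 4 (p. 75) and §2] [cite: HermonHutchcroft2021, §1 Conj. 1.1]
-/

namespace Summit.CriticalPhenomena.PercolationContinuityZ3.Theorems.Transplant

open Literature.Probability.Percolation Literature.Probability.LatticeModels

/-- **TARGET 4-C2(H-GRR) FOLLOWS FROM THE FRAMES-ONLY NODE**: `SamePDropOfSkeletonFrm₁ → HeisenbergGRRCriticalContinuity` — `θ(p_c) = 0` at the root of the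
point-symmetry-free Cayley graph `Cay(H₃(ℤ); {a, b, ab, ba²}^{±1})`, from the single-type frames-only drop node through the sheared one-type planar skeleton
`HeisGRR.skeletonFrm` (p1-g15).  The node is OPEN; this is the link by name, not a proof of the target. [cite: BenjaminiSchramm1996, Conj. 4 (p. 75)] -/
theorem heisenbergGRRCriticalContinuity_of_frmNode₁ (hD : SamePDropOfSkeletonFrm₁) : HeisenbergGRRCriticalContinuity :=
  HeisGRR.criticalContinuity_of_frmNode₁ hD ((0, 0, 0) : ℤ × ℤ × ℤ)

/-- **Every-vertex form from the node**: `SamePDropOfSkeletonFrm₁ → ∀ v, θ_X(v, p_c(X, v)) = 0` on the GRR carrier (the target's `_iff_all` normal form).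
[cite: BenjaminiSchramm1996, Conj. 4 (p. 75)] -/
theorem heisenbergGRRCriticalContinuity_all_of_frmNode₁ (hD : SamePDropOfSkeletonFrm₁) (v : ℤ × ℤ × ℤ) :
    theta HeisGRR.X v (criticalProbIOf HeisGRR.X v) = 0 :=
  heisenbergGRRCriticalContinuity_iff_all.1 (heisenbergGRRCriticalContinuity_of_frmNode₁ hD) v

end Summit.CriticalPhenomena.PercolationContinuityZ3.Theorems.Transplant
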